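import Summits.NavierStokesRegularity.NavierStokesRegularity.Theorems.CoriolisHeadTypeIRateDyadicPressureRate
import Summits.NavierStokesRegularity.NavierStokesRegularity.Theorems.CoriolisHeadTypeIRateDyadicTransport
import Summits.NavierStokesRegularity.NavierStokesRegularity.Theorems.CoriolisHeadTypeIRateOfGradientDecay
import HarnessLib

/-!
# CoriolisHeadTypeIRateOfSummableModulus — crux `NoCoRotatingCore` (stmt-NavierStokesRegularity-22676), line
# `far_field_constancy` v2 (skeleton 15c9a82ad206abb9), stub K1c `stub_typeIRate`:
# **THE THIRD DOOR — K1c from K1a with a square-summable dyadic modulus**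

`TypeIRate.typeIRate_of_summable_modulus`: the hypotheses of the registered stub K1c (bounded smooth div-free rotated
Leray profile, `ν, a > 0`, `B` skew, K1a, `U → b`) PLUS a square-summable dyadic modulus for the first derivative —
`‖y‖²‖DU(y)‖² ≤ θ_i` for `‖y‖ ≥ 2^i` with `θ` nonincreasing and `Σ θ_i < ∞` (bounded partial sums; e.g.
`‖y‖‖DU(y)‖ ≲ (log ‖y‖)^{−1/2−κ}`) — imply the Type-I rate `‖U(y) − b‖ ≤ K/(1 + ‖y‖)`.  So the logarithm of
`typeIRate_log_of_scaleNaturalDecay` is removed by ANY square-summable gain in K1a's modulus (K1a itself = `θ_i → 0`).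

Chain: `|ΔP| ≤ 3‖DU‖² ≤ 3θ_i/‖w‖²` on `‖w‖ ≥ 2^i`; the dyadic pressure-gradient profile `‖∇P(y) − g‖ ≤ Ψ_k/‖y‖` on
`2^k ≤ ‖y‖ ≤ 2^{k+1}` with `Σ_k Ψ_k < ∞` (`abs_fderiv_sub_inner_le_dyadic` + `sum_psi_le` here); the spiral transport
chained over dyadic shells in `‖y − c‖` (`norm_mul_norm_le_of_transport_linear_dyadic_shift`; one transport shell meets
at most three pressure shells).  HONEST FRAMING: K1c AS REGISTERED (plain K1a) stays OPEN; with
`typeIRate_of_third_order_decay` (third-order decay) and `typeIRate_log_of_scaleNaturalDecay` (log loss) this is the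
third kernel-checked side of the bracket.  Nothing here proves K1a, `NoCoRotatingCore`, Pineau–Vicol's Conjecture 1.1
or Navier–Stokes regularity.

References: line card `Lines/far_field_constancy.md` (K1c); B. Pineau, V. Vicol, arXiv:2607.09619 [PineauVicol2026].
-/

noncomputable section

open MeasureTheory Set Function Filter Topology Metric InnerProductSpace Real
open scoped RealInnerProductSpace BigOperators Laplacian ContDiff

-- the summit and its single sub-problem share the name (CONVENTIONS §1), as in every Theorems file
set_option linter.dupNamespace false

namespace Summit.NavierStokesRegularity.NavierStokesRegularity.Theorems.CoriolisHead

namespace TypeIRate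

open Literature.Analysis.FluidPDE

/-! ## §1 The dyadic profile has bounded partial sums -/

/-- Partial sums of the dyadic pressure profile
`Ψ_k = 64CV₁θ_{k−1} + 128C((4/3)I₁2^{−k} + (32/3)V₁2^{−k}Σ_{i≤k}θ_i2^i + 64V₁θ_{k+1})` are bounded by
`64CV₁(θ_0 + Θ) + 128C((8/3)I₁ + (64/3)V₁Θ + 64V₁Θ)` when `Σ_{i<n}θ_i ≤ Θ` for all `n`. -/
theorem sum_psi_le {θ : ℕ → ℝ} (hθ : ∀ i, 0 ≤ θ i) {Θ : ℝ} (hΘ : ∀ n, ∑ i ∈ Finset.range n, θ i ≤ Θ)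
    {C V₁ I₁ : ℝ} (hC : 0 ≤ C) (hV₁ : 0 ≤ V₁) (hI₁ : 0 ≤ I₁) (n : ℕ) :
    ∑ k ∈ Finset.range n, (64 * C * V₁ * θ (k - 1) +
        128 * C * (4 / 3 * I₁ / 2 ^ k + 32 / 3 * V₁ * (∑ i ∈ Finset.range (k + 1), θ i * 2 ^ i) / 2 ^ k +
          64 * V₁ * θ (k + 1))) ≤
      64 * C * V₁ * (θ 0 + Θ) + 128 * C * (8 / 3 * I₁ + 64 / 3 * V₁ * Θ + 64 * V₁ * Θ) := by
  have hΘ0 : 0 ≤ Θ := le_trans (by simp) (hΘ 0)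
  have p1 : ∑ k ∈ Finset.range n, θ (k - 1) ≤ θ 0 + Θ := by
    cases n with
    | zero => simp; linarith [hθ 0]
    | succ m =>
      rw [Finset.sum_range_succ']
      simp only [Nat.add_sub_cancel, Nat.zero_sub]
      linarith [hΘ m]
  have p2 : ∑ k ∈ Finset.range n, 4 / 3 * I₁ / (2 : ℝ) ^ k ≤ 8 / 3 * I₁ := by
    have h : ∑ k ∈ Finset.range n, 4 / 3 * I₁ / (2 : ℝ) ^ k = 4 / 3 * I₁ * ∑ k ∈ Finset.range n, (1 / 2 : ℝ) ^ k := by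
      rw [Finset.mul_sum]
      refine Finset.sum_congr rfl fun k _ => ?_
      rw [one_div_pow]; ring
    rw [h]
    nlinarith [(sum_range_half_pow_le n).1]
  have p3 : ∑ k ∈ Finset.range n, 32 / 3 * V₁ * (∑ i ∈ Finset.range (k + 1), θ i * 2 ^ i) / 2 ^ k ≤
      32 / 3 * V₁ * (2 * Θ) := by
    have h : ∑ k ∈ Finset.range n, 32 / 3 * V₁ * (∑ i ∈ Finset.range (k + 1), θ i * 2 ^ i) / 2 ^ k =
        32 / 3 * V₁ * ∑ k ∈ Finset.range n, (∑ i ∈ Finset.range (k + 1), θ i * 2 ^ i) / 2 ^ k := by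
      rw [Finset.mul_sum]
      refine Finset.sum_congr rfl fun k _ => ?_
      ring
    rw [h]
    refine mul_le_mul_of_nonneg_left ((sum_range_weighted_le_two_mul hθ n).trans ?_) (by positivity)
    linarith [hΘ n]
  have p4 : ∑ k ∈ Finset.range n, θ (k + 1) ≤ Θ := by
    have h := hΘ (n + 1)
    rw [Finset.sum_range_succ'] at h
    linarith [hθ 0]
  have e : ∑ k ∈ Finset.range n, (64 * C * V₁ * θ (k - 1) +
      128 * C * (4 / 3 * I₁ / 2 ^ k + 32 / 3 * V₁ * (∑ i ∈ Finset.range (k + 1), θ i * 2 ^ i) / 2 ^ k +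
        64 * V₁ * θ (k + 1))) =
      64 * C * V₁ * ∑ k ∈ Finset.range n, θ (k - 1) +
      128 * C * (∑ k ∈ Finset.range n, 4 / 3 * I₁ / (2 : ℝ) ^ k +
        ∑ k ∈ Finset.range n, 32 / 3 * V₁ * (∑ i ∈ Finset.range (k + 1), θ i * 2 ^ i) / 2 ^ k +
        64 * V₁ * ∑ k ∈ Finset.range n, θ (k + 1)) := by
    rw [Finset.mul_sum, Finset.mul_sum, ← Finset.sum_add_distrib, ← Finset.sum_add_distrib, Finset.mul_sum,
      ← Finset.sum_add_distrib]
  rw [e]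
  have hCV : 0 ≤ 64 * C * V₁ := by positivity
  have i1 := mul_le_mul_of_nonneg_left p1 hCV
  have i4 := mul_le_mul_of_nonneg_left p4 (by positivity : (0 : ℝ) ≤ 64 * V₁)
  have i2 : ∑ k ∈ Finset.range n, 4 / 3 * I₁ / (2 : ℝ) ^ k +
      ∑ k ∈ Finset.range n, 32 / 3 * V₁ * (∑ i ∈ Finset.range (k + 1), θ i * 2 ^ i) / 2 ^ k +
      64 * V₁ * ∑ k ∈ Finset.range n, θ (k + 1) ≤ 8 / 3 * I₁ + 64 / 3 * V₁ * Θ + 64 * V₁ * Θ := by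
    linarith
  have i3 := mul_le_mul_of_nonneg_left i2 (by positivity : (0 : ℝ) ≤ 128 * C)
  linarith

/-! ## §2 The profile theorem -/

section Profile

variable {ν a : ℝ} {B : EuclideanSpace ℝ (Fin 3) →L[ℝ] EuclideanSpace ℝ (Fin 3)}
  {U : EuclideanSpace ℝ (Fin 3) → EuclideanSpace ℝ (Fin 3)} {P : EuclideanSpace ℝ (Fin 3) → ℝ}

/-- **Step 1 — the dyadic pressure profile.**  For a bounded smooth div-free rotated profile with K1a and a dyadic
modulus `‖y‖²‖DU(y)‖² ≤ θ_i` on `‖y‖ ≥ 2^i` (`θ` nonincreasing, bounded partial sums), the pressure gradient has a far-field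
limit `g` and a dyadic profile: `‖∇P(y) − g‖ ≤ Ψ_k/‖y‖` on `2^k ≤ ‖y‖ ≤ 2^{k+1}` (`k ≥ 1`) with `Ψ ≥ 0` and bounded
partial sums. -/
theorem exists_dyadic_pressure_profile (hν : 0 < ν) (ha : 0 < a)
    (hB : ∀ x, inner ℝ (B x) x = 0) (hU : ContDiff ℝ (⊤ : ℕ∞) U) (hP : ContDiff ℝ 2 P)
    (hdiv : VectorCalculus.IsDivFree U)
    (heq : ∀ y, -(ν • (Δ U) y) + a • U y + a • fderiv ℝ U y y + (B (U y) - fderiv ℝ U y (B y)) +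
      convect U U y + gradient P y = 0)
    (hbdd : ∃ M : ℝ, ∀ y, ‖U y‖ ≤ M)
    (hdecay : ∀ ε : ℝ, 0 < ε → ∃ R : ℝ, ∀ y : EuclideanSpace ℝ (Fin 3), R ≤ ‖y‖ →
      ‖y‖ * ‖fderiv ℝ U y‖ + ‖y‖ ^ 2 * ‖iteratedFDeriv ℝ 2 U y‖ ≤ ε)
    {θ : ℕ → ℝ} {Θ : ℝ} (hanti : Antitone θ) (hΘ : ∀ n, ∑ i ∈ Finset.range n, θ i ≤ Θ)
    (hθU : ∀ (i : ℕ) (y : EuclideanSpace ℝ (Fin 3)), (2 : ℝ) ^ i ≤ ‖y‖ → ‖y‖ ^ 2 * ‖fderiv ℝ U y‖ ^ 2 ≤ θ i) :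
    ∃ (g : EuclideanSpace ℝ (Fin 3)) (Ψ : ℕ → ℝ) (Ψs : ℝ), (∀ k, 0 ≤ Ψ k) ∧
      (∀ n, ∑ k ∈ Finset.range n, Ψ k ≤ Ψs) ∧
      (∀ ε : ℝ, 0 < ε → ∃ R : ℝ, ∀ w : EuclideanSpace ℝ (Fin 3), R ≤ ‖w‖ → ‖gradient P w - g‖ ≤ ε) ∧
      ∀ k : ℕ, 1 ≤ k → ∀ y : EuclideanSpace ℝ (Fin 3), (2 : ℝ) ^ k ≤ ‖y‖ → ‖y‖ ≤ 2 ^ (k + 1) →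
        ‖gradient P y - g‖ ≤ Ψ k / ‖y‖ := by
  have hU3 : ContDiff ℝ 3 U := hU.of_le (by norm_cast)
  have hP1 : ContDiff ℝ 1 P := hP.of_le one_le_two
  have hPinf : ContDiff ℝ ∞ P := contDiff_pressure_of_rotated hU hP1 heq
  have hθ0 : ∀ i, 0 ≤ θ i := fun i => by
    obtain ⟨y₀, hy₀⟩ := exists_norm_eq (EuclideanSpace ℝ (Fin 3)) (pow_pos two_pos i).le
    exact le_trans (by positivity) (hθU i y₀ hy₀.ge)
  -- the Laplacian bound in dyadic currency, with `θ' = 3θ`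
  have hθ'0 : ∀ i, 0 ≤ 3 * θ i := fun i => by have := hθ0 i; positivity
  have hanti' : Antitone (fun i => 3 * θ i) := fun i j hij => by
    have := hanti hij; simp only; linarith
  have hΘ' : ∀ n, ∑ i ∈ Finset.range n, 3 * θ i ≤ 3 * Θ := fun n => by
    rw [← Finset.mul_sum]; exact mul_le_mul_of_nonneg_left (hΘ n) (by norm_num)
  have hΔ : ∀ (i : ℕ) (w : EuclideanSpace ℝ (Fin 3)), (2 : ℝ) ^ i ≤ ‖w‖ →
      |(Δ P) w| ≤ 3 * θ i / ‖w‖ ^ 2 := by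
    intro i w hw
    have hwpos : 0 < ‖w‖ := (pow_pos two_pos i).trans_le hw
    have hsq := abs_laplacian_pressure_le_sq hU3 hP hdiv heq w
    have h := hθU i w hw
    rw [le_div_iff₀ (pow_pos hwpos 2)]
    nlinarith
  obtain ⟨g, hg⟩ := FarFieldLimit.exists_gradient_pressure_limit hν ha hB hU hP hdiv heq hbdd hdecay
  obtain ⟨CΓ, hCΓ0, hCΓ⟩ := exists_sq_mul_norm_fderiv_newtonFar_le
  obtain ⟨V₁, hV₁⟩ : ∃ V : ℝ, V = (volume (ball (0 : EuclideanSpace ℝ (Fin 3)) 1)).toReal := ⟨_, rfl⟩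
  have hV₁0 : 0 ≤ V₁ := by rw [hV₁]; exact ENNReal.toReal_nonneg
  obtain ⟨I₁, hI₁⟩ : ∃ I : ℝ, I = ∫ w in closedBall (0 : EuclideanSpace ℝ (Fin 3)) 1, |(Δ P) w| := ⟨_, rfl⟩
  have hI₁0 : 0 ≤ I₁ := by rw [hI₁]; exact integral_nonneg fun _ => abs_nonneg _
  refine ⟨g, fun k => 64 * CΓ * V₁ * (3 * θ (k - 1)) +
    128 * CΓ * (4 / 3 * I₁ / 2 ^ k + 32 / 3 * V₁ * (∑ i ∈ Finset.range (k + 1), 3 * θ i * 2 ^ i) / 2 ^ k +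
      64 * V₁ * (3 * θ (k + 1))),
    64 * CΓ * V₁ * (3 * θ 0 + 3 * Θ) + 128 * CΓ * (8 / 3 * I₁ + 64 / 3 * V₁ * (3 * Θ) + 64 * V₁ * (3 * Θ)),
    fun k => ?_, fun n => sum_psi_le hθ'0 hΘ' hCΓ0 hV₁0 hI₁0 n, hg, fun k hk y hy1 hy2 => ?_⟩
  · have h1 := hθ0 (k - 1); have h2 := hθ0 (k + 1)
    have h3 : 0 ≤ ∑ i ∈ Finset.range (k + 1), 3 * θ i * 2 ^ i :=
      Finset.sum_nonneg fun i _ => by have := hθ0 i; positivity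
    positivity
  · have hypos : 0 < ‖y‖ := (pow_pos two_pos k).trans_le hy1
    have hΨk : 0 ≤ 64 * CΓ * V₁ * (3 * θ (k - 1)) +
        128 * CΓ * (4 / 3 * I₁ / 2 ^ k + 32 / 3 * V₁ * (∑ i ∈ Finset.range (k + 1), 3 * θ i * 2 ^ i) / 2 ^ k +
          64 * V₁ * (3 * θ (k + 1))) := by
      have h1 := hθ0 (k - 1); have h2 := hθ0 (k + 1)
      have h3 : 0 ≤ ∑ i ∈ Finset.range (k + 1), 3 * θ i * 2 ^ i :=
        Finset.sum_nonneg fun i _ => by have := hθ0 i; positivity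
      positivity
    refine FarFieldLimit.norm_le_of_forall_abs_inner_le (div_nonneg hΨk hypos.le) fun e => ?_
    rw [inner_sub_left, inner_gradient_left]
    have h := abs_fderiv_sub_inner_le_dyadic hCΓ0 hCΓ hPinf hθ'0 hanti' hΔ hg hk y hy1 hy2 e
    rw [← hV₁, ← hI₁] at h
    exact h

/-- **Step 2 — transport with a dyadic pressure profile.**  For a bounded smooth rotated profile with K1a, IF
`‖∇P(y) + ab + Bb‖ ≤ Ψ_k/‖y‖` on the dyadic shells `2^k ≤ ‖y‖ ≤ 2^{k+1}` (`k ≥ 1`) with `Ψ ≥ 0` of bounded partial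
sums, THEN `‖U(y) − b‖ ≤ K/(1 + ‖y‖)`: the chained spiral transport `norm_mul_norm_le_of_transport_linear_dyadic_shift`
(one transport shell in `‖y − c‖` meets at most three pressure shells). -/
theorem typeIRate_of_dyadic_pressure_profile (hν : 0 < ν) (ha : 0 < a)
    (hB : ∀ x, inner ℝ (B x) x = 0) (hU : ContDiff ℝ (⊤ : ℕ∞) U)
    (heq : ∀ y, -(ν • (Δ U) y) + a • U y + a • fderiv ℝ U y y + (B (U y) - fderiv ℝ U y (B y)) +
      convect U U y + gradient P y = 0)
    (hbdd : ∃ M : ℝ, ∀ y, ‖U y‖ ≤ M)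
    (hdecay : ∀ ε : ℝ, 0 < ε → ∃ R : ℝ, ∀ y : EuclideanSpace ℝ (Fin 3), R ≤ ‖y‖ →
      ‖y‖ * ‖fderiv ℝ U y‖ + ‖y‖ ^ 2 * ‖iteratedFDeriv ℝ 2 U y‖ ≤ ε)
    (b : EuclideanSpace ℝ (Fin 3))
    (hprof : ∃ (Ψ : ℕ → ℝ) (Ψs : ℝ), (∀ k, 0 ≤ Ψ k) ∧ (∀ n, ∑ k ∈ Finset.range n, Ψ k ≤ Ψs) ∧
      ∀ k : ℕ, 1 ≤ k → ∀ y : EuclideanSpace ℝ (Fin 3), (2 : ℝ) ^ k ≤ ‖y‖ → ‖y‖ ≤ 2 ^ (k + 1) →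
        ‖gradient P y + (a • b + B b)‖ ≤ Ψ k / ‖y‖) :
    ∃ K : ℝ, ∀ y : EuclideanSpace ℝ (Fin 3), ‖U y - b‖ ≤ K / (1 + ‖y‖) := by
  obtain ⟨Ψ, Ψs, hΨ0, hΨsum, hrate⟩ := hprof
  have hΨs0 : 0 ≤ Ψs := le_trans (by simp) (hΨsum 0)
  have hU2 : ContDiff ℝ 2 U := hU.of_le (by norm_cast)
  have hUd : Differentiable ℝ U := hU.differentiable (by simp)
  have hWd : Differentiable ℝ (fun z => U z - b) := hUd.sub_const b
  obtain ⟨M, hM⟩ := hbdd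
  obtain ⟨m, hm0, hWm⟩ : ∃ m : ℝ, 0 ≤ m ∧ ∀ z : EuclideanSpace ℝ (Fin 3), ‖U z - b‖ ≤ m :=
    ⟨M + ‖b‖, add_nonneg ((norm_nonneg _).trans (hM 0)) (norm_nonneg _),
      fun z => (norm_sub_le _ _).trans (add_le_add (hM z) le_rfl)⟩
  have hnegB : ∀ x, inner ℝ ((-B) x) x = 0 := fun x => by
    simp only [FunLike.coe_neg, Pi.neg_apply, inner_neg_left, hB x, neg_zero]
  obtain ⟨c, hc⟩ := FarFieldLimit.exists_add_clm_apply_eq_of_skew hnegB ha.ne' (-b)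
  have hc' : a • c - B c = -b := by
    simpa only [FunLike.coe_neg, Pi.neg_apply, ← sub_eq_add_neg] using hc
  obtain ⟨R₁, hR₁1, hR₁⟩ := FarFieldLimit.exists_radius_decay hdecay one_pos
  obtain ⟨k₀, hk₀⟩ := pow_unbounded_of_one_lt (max (max (2 * ‖c‖ + 2) (2 * R₁)) (max (8 / a) 4))
    (one_lt_two : (1 : ℝ) < 2)
  obtain ⟨R, hR⟩ : ∃ R : ℝ, R = (2 : ℝ) ^ k₀ := ⟨_, rfl⟩
  rw [← hR] at hk₀
  have hRc : 2 * ‖c‖ + 2 ≤ R := ((le_max_left _ _).trans (le_max_left _ _)).trans hk₀.le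
  have hRR₁ : 2 * R₁ ≤ R := ((le_max_right _ _).trans (le_max_left _ _)).trans hk₀.le
  have hRa : 8 / a ≤ R := ((le_max_left _ _).trans (le_max_right _ _)).trans hk₀.le
  have hR4 : (4 : ℝ) ≤ R := ((le_max_right _ _).trans (le_max_right _ _)).trans hk₀.le
  have hRpos : 0 < R := by linarith
  have hk₀2 : 2 ≤ k₀ := by
    rcases Nat.lt_or_ge k₀ 2 with h | h
    · exfalso
      have h2 : (2 : ℝ) ^ k₀ ≤ 2 ^ 1 := pow_le_pow_right₀ one_le_two (by omega)
      rw [pow_one, ← hR] at h2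
      linarith
    · exact h
  -- the transport profile: one transport shell meets at most three pressure shells
  obtain ⟨Φ, hΦ⟩ : ∃ Φ : ℕ → ℝ, Φ = fun j => 2 * (Ψ (k₀ + j - 1) + Ψ (k₀ + j) + Ψ (k₀ + j + 1)) := ⟨_, rfl⟩
  have hΦ0 : ∀ j, 0 ≤ Φ j := fun j => by
    have := hΨ0 (k₀ + j - 1); have := hΨ0 (k₀ + j); have := hΨ0 (k₀ + j + 1)
    rw [hΦ]; positivity
  have hΦs : ∀ n, ∑ j ∈ Finset.range n, Φ j ≤ 6 * Ψs := by
    intro n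
    have s1 : ∑ j ∈ Finset.range n, Ψ (k₀ + j - 1) ≤ Ψs := by
      have h := hΨsum (k₀ - 1 + n)
      rw [Finset.sum_range_add] at h
      have h0 : 0 ≤ ∑ x ∈ Finset.range (k₀ - 1), Ψ x := Finset.sum_nonneg fun x _ => hΨ0 x
      have e : ∑ x ∈ Finset.range n, Ψ (k₀ - 1 + x) = ∑ j ∈ Finset.range n, Ψ (k₀ + j - 1) :=
        Finset.sum_congr rfl fun j _ => by congr 1; omega
      linarith
    have s2 : ∑ j ∈ Finset.range n, Ψ (k₀ + j) ≤ Ψs := by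
      have h := hΨsum (k₀ + n)
      rw [Finset.sum_range_add] at h
      have h0 : 0 ≤ ∑ x ∈ Finset.range k₀, Ψ x := Finset.sum_nonneg fun x _ => hΨ0 x
      linarith
    have s3 : ∑ j ∈ Finset.range n, Ψ (k₀ + j + 1) ≤ Ψs := by
      have h := hΨsum (k₀ + 1 + n)
      rw [Finset.sum_range_add] at h
      have h0 : 0 ≤ ∑ x ∈ Finset.range (k₀ + 1), Ψ x := Finset.sum_nonneg fun x _ => hΨ0 x
      have e : ∑ x ∈ Finset.range n, Ψ (k₀ + 1 + x) = ∑ j ∈ Finset.range n, Ψ (k₀ + j + 1) :=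
        Finset.sum_congr rfl fun j _ => by congr 1; omega
      linarith
    have e : ∑ j ∈ Finset.range n, Φ j = 2 * (∑ j ∈ Finset.range n, Ψ (k₀ + j - 1) +
        ∑ j ∈ Finset.range n, Ψ (k₀ + j) + ∑ j ∈ Finset.range n, Ψ (k₀ + j + 1)) := by
      rw [hΦ, ← Finset.sum_add_distrib, ← Finset.sum_add_distrib, Finset.mul_sum]
    rw [e]
    linarith
  have hPshell : ∀ (j : ℕ) (y : EuclideanSpace ℝ (Fin 3)), R * 2 ^ j ≤ ‖y - c‖ → ‖y - c‖ ≤ R * 2 ^ (j + 1) →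
      ‖gradient P y + (a • b + B b)‖ ≤ Φ j / ‖y - c‖ := by
    intro j y hy1 hy2
    have hRj : R ≤ R * 2 ^ j := le_mul_of_one_le_right hRpos.le (one_le_pow₀ one_le_two)
    have hyc : R ≤ ‖y - c‖ := hRj.trans hy1
    have hycpos : 0 < ‖y - c‖ := hRpos.trans_le hyc
    have hsub : ‖y - c‖ ≤ ‖y‖ + ‖c‖ := norm_sub_le y c
    have hadd : ‖y‖ ≤ ‖y - c‖ + ‖c‖ := by
      have h := norm_add_le (y - c) c; rwa [sub_add_cancel] at h
    have hylo : ‖y - c‖ / 2 ≤ ‖y‖ := by linarith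
    have hyhi : ‖y‖ ≤ 2 * ‖y - c‖ := by linarith
    have hypos : 0 < ‖y‖ := by linarith
    have e1 : R * 2 ^ j = (2 : ℝ) ^ (k₀ + j) := by rw [hR, pow_add]
    have hlo : (2 : ℝ) ^ (k₀ + j - 1) ≤ ‖y‖ := by
      have h2 : (2 : ℝ) ^ (k₀ + j) = 2 ^ (k₀ + j - 1) * 2 := by
        rw [← pow_succ]; congr 1; omega
      rw [e1, h2] at hy1
      linarith
    have hhi : ‖y‖ ≤ (2 : ℝ) ^ (k₀ + j + 2) := by
      have h2 : (2 : ℝ) ^ (k₀ + j + 2) = R * 2 ^ (j + 1) * 2 := by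
        rw [hR, show k₀ + j + 2 = k₀ + (j + 1) + 1 by ring, pow_succ, pow_add]
      rw [h2]; linarith
    have hgrad : ‖gradient P y + (a • b + B b)‖ ≤ (Ψ (k₀ + j - 1) + Ψ (k₀ + j) + Ψ (k₀ + j + 1)) / ‖y‖ := by
      have hΨa := hΨ0 (k₀ + j - 1); have hΨb := hΨ0 (k₀ + j); have hΨc := hΨ0 (k₀ + j + 1)
      by_cases h1 : ‖y‖ ≤ (2 : ℝ) ^ (k₀ + j)
      · have h := hrate (k₀ + j - 1) (by omega) y hlo (by rwa [show k₀ + j - 1 + 1 = k₀ + j by omega])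
        refine h.trans (div_le_div_of_nonneg_right ?_ hypos.le)
        linarith
      by_cases h2 : ‖y‖ ≤ (2 : ℝ) ^ (k₀ + j + 1)
      · rw [not_le] at h1
        have h := hrate (k₀ + j) (by omega) y h1.le h2
        refine h.trans (div_le_div_of_nonneg_right ?_ hypos.le)
        linarith
      · rw [not_le] at h2
        have h := hrate (k₀ + j + 1) (by omega) y h2.le (by rwa [show k₀ + j + 1 + 1 = k₀ + j + 2 by ring])
        refine h.trans (div_le_div_of_nonneg_right ?_ hypos.le)
        linarith
    refine hgrad.trans ?_
    have hS0 : 0 ≤ Ψ (k₀ + j - 1) + Ψ (k₀ + j) + Ψ (k₀ + j + 1) := by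
      have := hΨ0 (k₀ + j - 1); have := hΨ0 (k₀ + j); have := hΨ0 (k₀ + j + 1); positivity
    have hΦj : Φ j = 2 * (Ψ (k₀ + j - 1) + Ψ (k₀ + j) + Ψ (k₀ + j + 1)) := by rw [hΦ]
    rw [hΦj, div_le_div_iff₀ hypos hycpos]
    have h2y : ‖y - c‖ ≤ 2 * ‖y‖ := by linarith
    have := mul_le_mul_of_nonneg_left h2y hS0
    linarith
  -- the transport inequality on dyadic shells beyond `R`
  have hT : ∀ (j : ℕ) (y : EuclideanSpace ℝ (Fin 3)), R * 2 ^ j ≤ ‖y - c‖ → ‖y - c‖ ≤ R * 2 ^ (j + 1) →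
      ‖fderiv ℝ (fun z => U z - b) y (a • (y - c) - B (y - c)) + (a • (U y - b) + B (U y - b))‖ ≤
        2 * ‖U y - b‖ / ‖y - c‖ + (12 * ν) / ‖y - c‖ ^ 2 + Φ j / ‖y - c‖ := by
    intro j y hy1 hy2
    have hRj : R ≤ R * 2 ^ j := le_mul_of_one_le_right hRpos.le (one_le_pow₀ one_le_two)
    have hy : R ≤ ‖y - c‖ := hRj.trans hy1
    have hyc : ‖y - c‖ / 2 ≤ ‖y‖ := by
      have h1 : ‖y - c‖ ≤ ‖y‖ + ‖c‖ := norm_sub_le y c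
      linarith
    have hycpos : 0 < ‖y - c‖ := hRpos.trans_le hy
    have hypos : 0 < ‖y‖ := by linarith
    have hyR₁ : R₁ ≤ ‖y‖ := by linarith
    obtain ⟨hD1, hD2⟩ := hR₁ y hyR₁
    rw [transport_form_of_rotated heq hc' y]
    have t1 : ‖ν • (Δ U) y‖ ≤ 12 * ν / ‖y - c‖ ^ 2 := by
      rw [norm_smul, Real.norm_of_nonneg hν.le]
      have h1 := norm_laplacian_le_three_mul_norm_iteratedFDeriv_two hU2 y
      have h3 : 1 / ‖y‖ ^ 2 ≤ 4 / ‖y - c‖ ^ 2 := by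
        rw [div_le_div_iff₀ (pow_pos hypos 2) (pow_pos hycpos 2)]
        nlinarith
      have h4 : ‖(Δ U) y‖ ≤ 3 * (4 / ‖y - c‖ ^ 2) := by linarith [hD2.trans h3]
      have h5 := mul_le_mul_of_nonneg_left h4 hν.le
      have e : ν * (3 * (4 / ‖y - c‖ ^ 2)) = 12 * ν / ‖y - c‖ ^ 2 := by ring
      linarith
    have t2 : ‖fderiv ℝ U y (U y - b)‖ ≤ 2 * ‖U y - b‖ / ‖y - c‖ := by
      have h1 : ‖fderiv ℝ U y‖ ≤ 2 / ‖y - c‖ := by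
        refine hD1.trans ?_
        rw [div_le_div_iff₀ hypos hycpos]
        linarith
      have h2 := ContinuousLinearMap.le_opNorm (fderiv ℝ U y) (U y - b)
      have h3 := mul_le_mul_of_nonneg_right h1 (norm_nonneg (U y - b))
      have e : 2 / ‖y - c‖ * ‖U y - b‖ = 2 * ‖U y - b‖ / ‖y - c‖ := by ring
      linarith
    have t3 := hPshell j y hy1 hy2
    have s1 := norm_sub_le (ν • (Δ U) y - fderiv ℝ U y (U y - b)) (gradient P y + (a • b + B b))
    have s2 := norm_sub_le (ν • (Δ U) y) (fderiv ℝ U y (U y - b))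
    linarith
  have hκR : (2 : ℝ) ≤ a * R / 4 := by
    have : 8 ≤ a * R := by rwa [div_le_iff₀' ha] at hRa
    linarith
  have hfar : ∀ y : EuclideanSpace ℝ (Fin 3), R ≤ ‖y - c‖ →
      ‖y - c‖ * ‖U y - b‖ ≤ 2 * (R * m + 2 * (12 * ν) / (a * R) + 2 * (6 * Ψs) / a) :=
    fun y hy => norm_mul_norm_le_of_transport_linear_dyadic_shift ha hB hWd c hRpos zero_le_two hκR
      (by positivity : (0 : ℝ) ≤ 12 * ν) hΦ0 hΦs hWm hT y hy
  obtain ⟨K₀, hK₀⟩ : ∃ K : ℝ, K = 2 * (R * m + 2 * (12 * ν) / (a * R) + 2 * (6 * Ψs) / a) := ⟨_, rfl⟩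
  have hK₀0 : 0 ≤ K₀ := by rw [hK₀]; positivity
  rw [← hK₀] at hfar
  refine ⟨max (K₀ * (2 + ‖c‖)) (m * (1 + R + ‖c‖)), fun y => ?_⟩
  have hypos1 : 0 < 1 + ‖y‖ := by positivity
  have hyle : ‖y‖ ≤ ‖y - c‖ + ‖c‖ := by
    have h := norm_add_le (y - c) c
    rwa [sub_add_cancel] at h
  rw [le_div_iff₀ hypos1]
  by_cases hfar' : R ≤ ‖y - c‖
  · have h1 : ‖y - c‖ * ‖U y - b‖ ≤ K₀ := hfar y hfar'
    have h2 : 1 + ‖y‖ ≤ ‖y - c‖ * (2 + ‖c‖) := by nlinarith [norm_nonneg c]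
    calc ‖U y - b‖ * (1 + ‖y‖) ≤ ‖U y - b‖ * (‖y - c‖ * (2 + ‖c‖)) :=
          mul_le_mul_of_nonneg_left h2 (norm_nonneg _)
      _ = (‖y - c‖ * ‖U y - b‖) * (2 + ‖c‖) := by ring
      _ ≤ K₀ * (2 + ‖c‖) := mul_le_mul_of_nonneg_right h1 (by positivity)
      _ ≤ max (K₀ * (2 + ‖c‖)) (m * (1 + R + ‖c‖)) := le_max_left _ _
  · rw [not_le] at hfar'
    have h2 : 1 + ‖y‖ ≤ 1 + R + ‖c‖ := by linarith
    calc ‖U y - b‖ * (1 + ‖y‖) ≤ m * (1 + R + ‖c‖) := mul_le_mul (hWm y) h2 hypos1.le hm0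
      _ ≤ max (K₀ * (2 + ‖c‖)) (m * (1 + R + ‖c‖)) := le_max_right _ _

/-- **K1c from K1a with a square-summable dyadic modulus** (see the module docstring).
[cite: PineauVicol2026, Conj. 1.1, Prop. 3.1] -/
theorem typeIRate_of_summable_modulus (hν : 0 < ν) (ha : 0 < a)
    (hB : ∀ x, inner ℝ (B x) x = 0) (hU : ContDiff ℝ (⊤ : ℕ∞) U) (hP : ContDiff ℝ 2 P)
    (hdiv : VectorCalculus.IsDivFree U)
    (heq : ∀ y, -(ν • (Δ U) y) + a • U y + a • fderiv ℝ U y y + (B (U y) - fderiv ℝ U y (B y)) +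
      convect U U y + gradient P y = 0)
    (hbdd : ∃ M : ℝ, ∀ y, ‖U y‖ ≤ M)
    (hdecay : ∀ ε : ℝ, 0 < ε → ∃ R : ℝ, ∀ y : EuclideanSpace ℝ (Fin 3), R ≤ ‖y‖ →
      ‖y‖ * ‖fderiv ℝ U y‖ + ‖y‖ ^ 2 * ‖iteratedFDeriv ℝ 2 U y‖ ≤ ε)
    (b : EuclideanSpace ℝ (Fin 3))
    (hlim : ∀ ε : ℝ, 0 < ε → ∃ R : ℝ, ∀ y : EuclideanSpace ℝ (Fin 3), R ≤ ‖y‖ → ‖U y - b‖ ≤ ε)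
    (hmod : ∃ (θ : ℕ → ℝ) (Θ : ℝ), Antitone θ ∧ (∀ n, ∑ i ∈ Finset.range n, θ i ≤ Θ) ∧
      ∀ (i : ℕ) (y : EuclideanSpace ℝ (Fin 3)), (2 : ℝ) ^ i ≤ ‖y‖ → ‖y‖ ^ 2 * ‖fderiv ℝ U y‖ ^ 2 ≤ θ i) :
    ∃ K : ℝ, ∀ y : EuclideanSpace ℝ (Fin 3), ‖U y - b‖ ≤ K / (1 + ‖y‖) := by
  obtain ⟨θ, Θ, hanti, hΘ, hθU⟩ := hmod
  obtain ⟨g, Ψ, Ψs, hΨ0, hΨsum, hg, hrate⟩ :=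
    exists_dyadic_pressure_profile hν ha hB hU hP hdiv heq hbdd hdecay hanti hΘ hθU
  have hgb : g = -(a • b + B b) := gradient_limit_eq hν ha hU heq hbdd hdecay hlim hg
  refine typeIRate_of_dyadic_pressure_profile hν ha hB hU heq hbdd hdecay b ⟨Ψ, Ψs, hΨ0, hΨsum, ?_⟩
  intro k hk y hy1 hy2
  have h := hrate k hk y hy1 hy2
  rwa [hgb, sub_neg_eq_add] at h

end Profile

end TypeIRate

end Summit.NavierStokesRegularity.NavierStokesRegularity.Theorems.CoriolisHead

end
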